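import Summits.AtomisticToContinuum.FouriersLaw.Theorems.OddSectorIrreversibilityTapLeakBoundHermiteOfMixedTap
import Summits.AtomisticToContinuum.FouriersLaw.Theorems.OddSectorIrreversibilityTapLeakBoundPositionTapGlue
import Summits.AtomisticToContinuum.FouriersLaw.Theorems.OddSectorIrreversibilityTapLeakBoundFloorSupKickCone

/-!
# `TapLeakBound` (stmt-AtomisticToContinuum-15159), line `SketchIdeator2`: the crux in EVERY POWER WINDOW, reduced to PTB alone

Helper file (`--supports stmt-AtomisticToContinuum-15159`) for crux P = `…Theses.OddSectorIrreversibility.TapLeakBound`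
(skeleton v11: P ⇐ PTB `stub_positionTapBudget` ∧ F `stub_kickCone`, both `N`-uniform bets). The flow-side bet F asks
for the resampled-kick `L²(Gibbs)` cone of the closed chain in a LINEAR window `s ≤ a·d`; its SECOND FLOOR — the same
cone in every POWER window `s^{4m₀} ≤ a(1+d)^{4m₀-1}`, `m₀ ≥ 1` — is LANDED (`stub_floorSupKickCone`,
…FloorSupKickCone.lean). This file threads the power window through the landed glue (pairing bound
`abs_pairing_le_sqrt_mul_sqrt` = Gaussian IBP + resampling orthogonality + Cauchy–Schwarz, …SplitGlue.lean; H1 from the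
mixed tap bound, …HermiteOfMixedTap.lean; the mixed tap bound from PTB, …PositionTapGlue.lean) and records, kernel-checked:

* `tapLeakBound_pow_of_hermite m₀` — **H1 → P_{m₀}** with the flow side PROVED: for every `m₀ ≥ 1` the crux's
  inequality `|T ∫ ∂_{p_b}u⁺ · ∂_{p_b}(j_i∘Φ_s) dμ_T| ≤ C·√((|∫u·J dμ_T| + Z)·Z)·(1+d)^{-3/2}` holds for all `N, i, b, u` as
  in P and all `s ≥ 0` with `s^{4m₀} ≤ a·(1+d)^{4m₀-1}` (P's statement with its window `s ≤ a·d` replaced by the power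
  window and its profile `(1 + d − s/a)^{-3/2}` by `(1+d)^{-3/2}`), GIVEN H1 (`BoundaryHermiteRegularity`);
* `tapLeakBound_pow_of_mixedTapBound m₀` — **MixedTapBound → P_{m₀}**;
* `tapLeakBound_pow_of_positionTapBudget m₀` / `stub_powWindowTapLeak` — **PTB → P_{m₀} for every `m₀ ≥ 1`**: the
  power-window form of the crux is reduced to the SINGLE first-order corrector-side bet PTB; nothing else is open in it.

What this is NOT: P itself (linear window, needed by `WitnessGlue`'s bookkeeping `Σ_i τ_i ≍ N²`; with the power window
the witness gives `D_N ≲ N^{1/(8m₀)}` only). References: folklore. Nothing here closes the item.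
-/

noncomputable section

open MeasureTheory ProbabilityTheory Filter Topology Set Function
open scoped NNReal ENNReal ContDiff

namespace Summit.AtomisticToContinuum.FouriersLaw.Theorems.OddSectorIrreversibility.TapLeak

open Literature.MathematicalPhysics.KineticTheory.HeatConduction
open Literature.MathematicalPhysics.KineticTheory
open Summit.AtomisticToContinuum.FouriersLaw.Theorems.ClosedConeSensitivity.Negative.ZeroFrictionDictionary
open Summit.AtomisticToContinuum.FouriersLaw.Theorems.OddSectorWitness
open Summit.AtomisticToContinuum.FouriersLaw.Theorems.OddSectorIrreversibility.Corrector

/-- **H1 → P in every power window** (flow side PROVED by `stub_floorSupKickCone`): given the boundary Hermite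
regularity `‖𝒩_b u⁺‖²_{μ_T} ≤ C_H(|⟨u,J⟩| + Z)` of the Kubo corrector (`N`-uniform), for every `m₀ ≥ 1` there are `a > 0`, `C`
with `|T ∫ ∂_{p_b}u⁺ ∂_{p_b}(j_i∘Φ_s) dμ_T| ≤ C √((|∫uJ dμ_T| + Z) Z) / (1+d)^{3/2}` whenever `s ≥ 0`,
`s^{4m₀} ≤ a(1+d)^{4m₀-1}` (pairing bound × the landed power-window kick cone; `a = a_K`, `C = √(max C_H 0 · C_K)`). [folklore] -/
theorem tapLeakBound_pow_of_hermite (m₀ : ℕ) (hm : 1 ≤ m₀)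
    (hH1 : ∀ ω₂ lam β γ : ℝ, 0 < ω₂ → 0 < lam → 0 < β → 0 < γ → ∀ T : ℝ, 0 < T →
      ∃ C : ℝ, ∀ (N : ℕ) (b : Fin N) (u : PhaseSpace N → ℝ), (b.val = 0 ∨ b.val = N - 1) →
        ContDiff ℝ 1 u → MemLp u 2 (gibbsWeight ω₂ lam β γ N T) →
        (∀ᵐ x ∂(gibbsWeight ω₂ lam β γ N T), Tendsto (fun τ : ℝ => ∫ t in Set.Ioc (0 : ℝ) τ,
            (∫ y, (∑ k : Fin N, (pinnedChain ω₂ lam β γ).bondCurrent N k y)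
              ∂((pinnedChain ω₂ lam β γ).transitionKernel N T T t.toNNReal x))) atTop (𝓝 (u x))) →
          MemLp (fun x : PhaseSpace N => -(T * partialP b (partialP b (fun y : PhaseSpace N => (u y + u (y.1, -y.2)) / 2)) x) +
            x.2 b * partialP b (fun y : PhaseSpace N => (u y + u (y.1, -y.2)) / 2) x) 2 (gibbsWeight ω₂ lam β γ N T) ∧
          ∫ x, (-(T * partialP b (partialP b (fun y : PhaseSpace N => (u y + u (y.1, -y.2)) / 2)) x) +
              x.2 b * partialP b (fun y : PhaseSpace N => (u y + u (y.1, -y.2)) / 2) x) ^ 2 ∂(gibbsWeight ω₂ lam β γ N T) ≤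
            C * (|∫ x, u x * (∑ k : Fin N, (pinnedChain ω₂ lam β γ).bondCurrent N k x) ∂(gibbsWeight ω₂ lam β γ N T)| +
              ∫ x, Real.exp (-((pinnedChain ω₂ lam β γ).hamiltonian N x) / T) ∂volume)) :
    ∀ ω₂ lam β γ : ℝ, 0 < ω₂ → 0 < lam → 0 < β → 0 < γ → ∀ T : ℝ, 0 < T → ∃ a C : ℝ, 0 < a ∧
      ∀ (N : ℕ) (i b : Fin N) (u : PhaseSpace N → ℝ) (s : ℝ), (b.val = 0 ∨ b.val = N - 1) → 0 ≤ s →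
        let P := pinnedChain ω₂ lam β γ
        let P₀ := pinnedChain ω₂ lam β 0
        let μT : Measure (PhaseSpace N) :=
          volume.withDensity (fun x : PhaseSpace N => ENNReal.ofReal (Real.exp (-(P.hamiltonian N x) / T)))
        let J : PhaseSpace N → ℝ := fun z => ∑ k : Fin N, P.bondCurrent N k z
        let ue : PhaseSpace N → ℝ := fun x => (u x + u (x.1, -x.2)) / 2
        let js : PhaseSpace N → ℝ := fun x => ∫ y, P.bondCurrent N i y ∂(P₀.transitionKernel N T T s.toNNReal x)
        let d : ℕ := (if b.val = 0 then i.val else N - 2 - i.val)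
        ContDiff ℝ 1 u → MemLp u 2 μT →
        (∀ᵐ x ∂μT, Tendsto (fun τ : ℝ => ∫ t in Set.Ioc (0 : ℝ) τ,
            (∫ y, J y ∂(P.transitionKernel N T T t.toNNReal x))) atTop (𝓝 (u x))) →
        s ^ (4 * m₀) ≤ a * (1 + (d : ℝ)) ^ (4 * m₀ - 1) →
          |T * ∫ x, partialP b ue x * partialP b js x ∂μT| ≤
            C * Real.sqrt ((|∫ x, u x * J x ∂μT| + ∫ x, Real.exp (-(P.hamiltonian N x) / T) ∂volume) *
              ∫ x, Real.exp (-(P.hamiltonian N x) / T) ∂volume) / (1 + (d : ℝ)) ^ (3 / 2 : ℝ) := by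
  intro ω₂ lam β γ hω hl hβ hγ T hT
  obtain ⟨CH₀, hH⟩ := hH1 ω₂ lam β γ hω hl hβ hγ T hT
  obtain ⟨a, CK, ha, hK⟩ := stub_floorSupKickCone ω₂ lam β γ hω hl hβ hγ T hT m₀ hm
  set CH : ℝ := max CH₀ 0 with hCHdef
  have hCH0 : 0 ≤ CH := le_max_right _ _
  -- `C_K ≥ 0`: the kick-cone bound at `s = 0`, `d = 0` reads `0 ≤ C_K · Z` with `Z > 0` (not needed: clip it instead)
  set CK' : ℝ := max CK 0 with hCK'def
  have hCK0 : 0 ≤ CK' := le_max_right _ _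
  refine ⟨a, Real.sqrt (CH * CK'), ha, fun N i b u s hb hs => ?_⟩
  dsimp only
  intro hu1 hu2 hlim hsd
  set P := pinnedChain ω₂ lam β γ with hP
  set μ := gibbsWeight ω₂ lam β γ N T with hμ
  set Z : ℝ := ∫ x, Real.exp (-(P.hamiltonian N x) / T) ∂volume with hZ
  set d : ℕ := (if b.val = 0 then i.val else N - 2 - i.val) with hd
  set ue : PhaseSpace N → ℝ := fun y => (u y + u (y.1, -y.2)) / 2 with hue
  set Nue : PhaseSpace N → ℝ := fun x => -(T * partialP b (partialP b ue) x) + x.2 b * partialP b ue x with hNue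
  have hjs : ∀ x : PhaseSpace N, ∫ y, P.bondCurrent N i y
      ∂((pinnedChain ω₂ lam β 0).transitionKernel N T T s.toNNReal x) =
      P.bondCurrent N i (detFlow ω₂ lam β N s x) := fun x => by
    rw [integral_transitionKernel_zero_friction hω hl.le hβ.le, Real.coe_toNNReal s hs]
  obtain ⟨hu, hpde⟩ := stub_correctorSmooth hω hl hβ hγ hT hu1.continuous hlim
  obtain ⟨hN2, hNle⟩ := hH N b u hb hu1 hu2 hlim
  have hV := hK N i b s hb hs hsd
  simp only [hjs] at hV
  have hpair := abs_pairing_le_sqrt_mul_sqrt hω hl hβ hγ hT i b hb hu hu2 hpde hN2 hs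
  simp only [hjs]
  refine hpair.trans ?_
  set M : ℝ := |∫ x, u x * ∑ k : Fin N, P.bondCurrent N k x ∂μ| + Z with hM
  set D : ℝ := 1 + (d : ℝ) with hD
  have hZ0 : 0 ≤ Z := integral_nonneg fun x => (Real.exp_pos _).le
  have hM0 : 0 ≤ M := add_nonneg (abs_nonneg _) hZ0
  have hD0 : 0 < D := by have : (0 : ℝ) ≤ d := Nat.cast_nonneg d; rw [hD]; linarith
  have hNle' : ∫ x, (Nue x) ^ 2 ∂μ ≤ CH * M :=
    hNle.trans (mul_le_mul_of_nonneg_right (le_max_left _ _) hM0)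
  have h1 : Real.sqrt (∫ x, (Nue x) ^ 2 ∂μ) ≤ Real.sqrt (CH * M) := Real.sqrt_le_sqrt hNle'
  have h2 : Real.sqrt (∫ x, (∫ p', (P.bondCurrent N i (detFlow ω₂ lam β N s (x.1, Function.update x.2 b p')) -
      P.bondCurrent N i (detFlow ω₂ lam β N s x)) ^ 2 ∂(gaussianReal 0 (Real.toNNReal T))) ∂μ) ≤
      Real.sqrt (CK' * Z / D ^ 3) := by
    refine Real.sqrt_le_sqrt (hV.trans ?_)
    exact div_le_div_of_nonneg_right (mul_le_mul_of_nonneg_right (le_max_left _ _) hZ0) (pow_nonneg hD0.le 3)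
  have hD32 : Real.sqrt (D ^ 3) = D ^ (3 / 2 : ℝ) := by
    rw [Real.sqrt_eq_rpow, ← Real.rpow_natCast, ← Real.rpow_mul hD0.le]
    norm_num
  calc Real.sqrt (∫ x, (Nue x) ^ 2 ∂μ) *
        Real.sqrt (∫ x, (∫ p', (P.bondCurrent N i (detFlow ω₂ lam β N s (x.1, Function.update x.2 b p')) -
          P.bondCurrent N i (detFlow ω₂ lam β N s x)) ^ 2 ∂(gaussianReal 0 (Real.toNNReal T))) ∂μ)
      ≤ Real.sqrt (CH * M) * Real.sqrt (CK' * Z / D ^ 3) :=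
        mul_le_mul h1 h2 (Real.sqrt_nonneg _) (Real.sqrt_nonneg _)
    _ = Real.sqrt (CH * CK') * Real.sqrt (M * Z) / Real.sqrt (D ^ 3) := by
        rw [Real.sqrt_div' _ (pow_nonneg hD0.le 3), ← mul_div_assoc]
        congr 1
        rw [← Real.sqrt_mul (mul_nonneg hCH0 hM0), ← Real.sqrt_mul (mul_nonneg hCH0 hCK0)]
        congr 1; ring
    _ = Real.sqrt (CH * CK') * Real.sqrt (M * Z) / D ^ (3 / 2 : ℝ) := by rw [hD32]

/-- **MixedTapBound → P in every power window** (`T∫∂_{q_b}u ∂_{p_b}u dμ_T ≤ C(|⟨u,J⟩| + Z)`, `N`-uniform, gives H1 by the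
landed `boundaryHermiteRegularity_of_mixedTapBound`; then `tapLeakBound_pow_of_hermite`). [folklore] -/
theorem tapLeakBound_pow_of_mixedTapBound (m₀ : ℕ) (hm : 1 ≤ m₀)
    (hMix : ∀ ω₂ lam β γ : ℝ, 0 < ω₂ → 0 < lam → 0 < β → 0 < γ → ∀ T : ℝ, 0 < T →
      ∃ C : ℝ, ∀ (N : ℕ) (b : Fin N) (u : PhaseSpace N → ℝ), (b.val = 0 ∨ b.val = N - 1) →
        ContDiff ℝ 1 u → MemLp u 2 (gibbsWeight ω₂ lam β γ N T) →
        (∀ᵐ x ∂(gibbsWeight ω₂ lam β γ N T), Tendsto (fun τ : ℝ => ∫ t in Set.Ioc (0 : ℝ) τ,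
            (∫ y, (∑ k : Fin N, (pinnedChain ω₂ lam β γ).bondCurrent N k y)
              ∂((pinnedChain ω₂ lam β γ).transitionKernel N T T t.toNNReal x))) atTop (𝓝 (u x))) →
          MemLp (partialQ b u) 2 (gibbsWeight ω₂ lam β γ N T) ∧
          T * ∫ x, partialQ b u x * partialP b u x ∂(gibbsWeight ω₂ lam β γ N T) ≤
            C * (|∫ x, u x * (∑ k : Fin N, (pinnedChain ω₂ lam β γ).bondCurrent N k x) ∂(gibbsWeight ω₂ lam β γ N T)| +
              ∫ x, Real.exp (-((pinnedChain ω₂ lam β γ).hamiltonian N x) / T) ∂volume)) :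
    ∀ ω₂ lam β γ : ℝ, 0 < ω₂ → 0 < lam → 0 < β → 0 < γ → ∀ T : ℝ, 0 < T → ∃ a C : ℝ, 0 < a ∧
      ∀ (N : ℕ) (i b : Fin N) (u : PhaseSpace N → ℝ) (s : ℝ), (b.val = 0 ∨ b.val = N - 1) → 0 ≤ s →
        let P := pinnedChain ω₂ lam β γ
        let P₀ := pinnedChain ω₂ lam β 0
        let μT : Measure (PhaseSpace N) :=
          volume.withDensity (fun x : PhaseSpace N => ENNReal.ofReal (Real.exp (-(P.hamiltonian N x) / T)))
        let J : PhaseSpace N → ℝ := fun z => ∑ k : Fin N, P.bondCurrent N k z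
        let ue : PhaseSpace N → ℝ := fun x => (u x + u (x.1, -x.2)) / 2
        let js : PhaseSpace N → ℝ := fun x => ∫ y, P.bondCurrent N i y ∂(P₀.transitionKernel N T T s.toNNReal x)
        let d : ℕ := (if b.val = 0 then i.val else N - 2 - i.val)
        ContDiff ℝ 1 u → MemLp u 2 μT →
        (∀ᵐ x ∂μT, Tendsto (fun τ : ℝ => ∫ t in Set.Ioc (0 : ℝ) τ,
            (∫ y, J y ∂(P.transitionKernel N T T t.toNNReal x))) atTop (𝓝 (u x))) →
        s ^ (4 * m₀) ≤ a * (1 + (d : ℝ)) ^ (4 * m₀ - 1) →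
          |T * ∫ x, partialP b ue x * partialP b js x ∂μT| ≤
            C * Real.sqrt ((|∫ x, u x * J x ∂μT| + ∫ x, Real.exp (-(P.hamiltonian N x) / T) ∂volume) *
              ∫ x, Real.exp (-(P.hamiltonian N x) / T) ∂volume) / (1 + (d : ℝ)) ^ (3 / 2 : ℝ) :=
  tapLeakBound_pow_of_hermite m₀ hm (boundaryHermiteRegularity_of_mixedTapBound hMix)

/-- **PTB → P in every power window, for every `m₀ ≥ 1`** (registered sub-goal `stub_powWindowTapLeak` of the line):
the `N`-uniform position tap budget PTB (`∂_{q_b}u ∈ L²(μ_T)`, `‖∂_{q_b}u‖² ≤ C(|⟨u,J⟩| + Z)`) — the ONLY corrector-side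
bet of skeleton v11 — implies the crux's inequality in every power window `s^{4m₀} ≤ a(1+d)^{4m₀-1}` with profile
`(1+d)^{-3/2}`: PTB ⇒ MixedTapBound (`stub_mixedTapOfPositionTap`) ⇒ H1 ⇒ pairing bound × the landed second floor of the
kick cone. The power-window form of the crux thus rests on PTB alone. [folklore] -/
theorem stub_powWindowTapLeak : (∀ ω₂ lam β γ : ℝ, 0 < ω₂ → 0 < lam → 0 < β → 0 < γ → ∀ T : ℝ, 0 < T → ∃ C : ℝ, ∀ (N : ℕ) (b : Fin N) (u : PhaseSpace N → ℝ), (b.val = 0 ∨ b.val = N - 1) → ContDiff ℝ 1 u → MemLp u 2 (gibbsWeight ω₂ lam β γ N T) → (∀ᵐ x ∂(gibbsWeight ω₂ lam β γ N T), Tendsto (fun τ : ℝ => ∫ t in Set.Ioc (0 : ℝ) τ, (∫ y, (∑ k : Fin N, (pinnedChain ω₂ lam β γ).bondCurrent N k y) ∂((pinnedChain ω₂ lam β γ).transitionKernel N T T t.toNNReal x))) atTop (𝓝 (u x))) → MemLp (partialQ b u) 2 (gibbsWeight ω₂ lam β γ N T) ∧ ∫ x, (partialQ b u x) ^ 2 ∂(gibbsWeight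 ω₂ lam β γ N T) ≤ C * (|∫ x, u x * (∑ k : Fin N, (pinnedChain ω₂ lam β γ).bondCurrent N k x) ∂(gibbsWeight ω₂ lam β γ N T)| + ∫ x, Real.exp (-((pinnedChain ω₂ lam β γ).hamiltonian N x) / T) ∂volume)) → ∀ (m₀ : ℕ), 1 ≤ m₀ → ∀ ω₂ lam β γ : ℝ, 0 < ω₂ → 0 < lam → 0 < β → 0 < γ → ∀ T : ℝ, 0 < T → ∃ a C : ℝ, 0 < a ∧ ∀ (N : ℕ) (i b : Fin N) (u : PhaseSpace N → ℝ) (s : ℝ), (b.val = 0 ∨ b.val = N - 1) → 0 ≤ s → let P := pinnedChain ω₂ lam β γ; let P₀ := pinnedChain ω₂ lam β 0; let μT : Measure (PhaseSpace N) := volume.withDensity (fun x : PhaseSpace N => ENNReal.ofReal (Real.exp (-(P.hamiltonian N x) / T))); let J : PhaseSpace N → ℝ := fun z => ∑ k : Fin N, P.bondCurrent N k z; let ue : PhaseSpace N → ℝ := fun x => (u x + u (x.1, -x.2)) / 2; let js : PhaseSpace N → ℝ := fun x => ∫ y, P.bondCurrent N i y ∂(P₀.transitionKernel N T T s.toNNReal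 x); let d : ℕ := (if b.val = 0 then i.val else N - 2 - i.val); ContDiff ℝ 1 u → MemLp u 2 μT → (∀ᵐ x ∂μT, Tendsto (fun τ : ℝ => ∫ t in Set.Ioc (0 : ℝ) τ, (∫ y, J y ∂(P.transitionKernel N T T t.toNNReal x))) atTop (𝓝 (u x))) → s ^ (4 * m₀) ≤ a * (1 + (d : ℝ)) ^ (4 * m₀ - 1) → |T * ∫ x, partialP b ue x * partialP b js x ∂μT| ≤ C * Real.sqrt ((|∫ x, u x * J x ∂μT| + ∫ x, Real.exp (-(P.hamiltonian N x) / T) ∂volume) * ∫ x, Real.exp (-(P.hamiltonian N x) / T) ∂volume) / (1 + (d : ℝ)) ^ (3 / 2 : ℝ) :=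
  fun hPTB m₀ hm => tapLeakBound_pow_of_mixedTapBound m₀ hm (stub_mixedTapOfPositionTap hPTB)

end Summit.AtomisticToContinuum.FouriersLaw.Theorems.OddSectorIrreversibility.TapLeak

end
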